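import Literature.NumberTheory.Automorphic.ReductiveDualChevalleyBasedProofs
import Literature.NumberTheory.Automorphic.IsomorphismTheoremUniqueProofs
import Literature.NumberTheory.Automorphic.ChevalleyRootRep
import Literature.NumberTheory.Automorphic.ChevalleyGroupRootDatum
import Literature.NumberTheory.Automorphic.ChevalleySystem
import Literature.NumberTheory.Automorphic.GLReindex
import HarnessLib

/-!
# Chevalley's existence theorem (Springer 10.1.1): based ⇔ unbased, and the discharge of both

Trunk T-AUTOMORPHIC (G25 AutomorphicL), **lang.S13** (c). The named facts
`Literature.NumberTheory.Automorphic.chevalley_existence` (Springer, *Linear Algebraic Groups*,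
2nd ed., Thm 10.1.1: every reduced root datum over an algebraically closed field of
characteristic `0` is the root datum `Ψ(G, T)` of a connected reductive `G ≤ GL_N(k)` with maximal
torus `T`) and `Literature.NumberTheory.Automorphic.chevalley_existence_based` (the same for based
root data `(P, b)`, with a Borel subgroup `B ⊇ T` adapted to `b` and a pinning; Springer 10.1.1
with 8.2.4 (i), 9.6.1) are **equivalent**, and this file records the easy direction that was
still missing from the tree:

* `chevalley_existence_of_chevalley_existence_based` (proved): a reduced root datum over `ℤ`
  with finitely many roots has a base (`RootPairing.nonempty_base_int`, the tree's integral form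
  of Mathlib's `RootPairing.nonempty_base`; Bourbaki *Lie* VI §1.5 Thm 2, Springer 7.4.5), and a
  based realization `(G, B, T)` of `(P, b)` is in particular a realization `(G, T)` of `P`
  (`IsBasedRootDatumOf.isRootDatumOf`);
* `chevalley_existence_iff_chevalley_existence_based` (proved): together with the converse
  `chevalley_existence_based_of_chevalley_existence` of `ReductiveDualChevalleyBasedProofs.lean`
  (Borel subgroup `B(b) = ⟨T, U_α : α > 0⟩` and pinning from a realization, everything proved).

Consequently the two facts have one and the same open leaf, Springer's construction 10.1.1
itself, which is being assembled in the tree in representation-theoretic form: the Lie algebra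
with Chevalley system of the datum (`ChevalleySystem.lean`, from Mathlib's Geck construction),
its highest weight modules (`ChevalleyVerma.lean`, `ChevalleyVermaWeights.lean`,
`ChevalleyIrreducible.lean`), the infinitesimal data `RootRep` (`ChevalleyGroupData.lean`) and
the group `G = ⟨T_X, exp (x E_α)⟩` (`ChevalleyGroupBasic.lean`, `ChevalleyGroupLie.lean`,
`ChevalleyGroupStructure.lean`: connected reductive, `T_X` a maximal torus, roots `R`). Whichever
of `chevalley_existence_holds`, `chevalley_existence_based_holds` lands first yields the other
through this file. No definitions, no new named facts.

## The discharge (added)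

* `chevalley_existence_holds : chevalley_existence k` — **every reduced root datum over an
  algebraically closed field of characteristic `0` is the root datum of a connected reductive
  `G ≤ GL_N(k)` with a maximal torus `T`** [cite: SpringerLAG1998, Thm 10.1.1], assembled from
  the tree: a base `b` (`RootPairing.nonempty_base_int`); a Chevalley system `(h_s, e_α)` of a
  Lie algebra over `k` with the relations of `P` (`exists_isChevalleySystem`,
  `ChevalleySystem.lean`); for dominant `Λ ∈ X` the finite-dimensional irreducible highest weight
  module `L(Λ)` (`ChevalleyVerma.lean`, `ChevalleyVermaWeights.lean`, `ChevalleyIrreducible.lean`,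
  `ChevalleyIntegrable.lean`, `RootDatumWeights.lean`) and its block of root matrices
  (`ChevalleyBlock.lean`); the family `V = ⊕_j L(Λ_j)` over dominant regular representatives of
  `X` modulo the root lattice, whose weights generate `X` (`ChevalleyRootRep.lean`:
  `theRootRep : RootRep k P b _ _`); the group `G = ⟨T_X, exp (x E_α)⟩ ≤ GL(V)`, connected
  reductive with maximal torus `T_X` and root datum `P` (`RootRep.exists_isRootDatumOf`,
  `ChevalleyGroupRootDatum.lean`, Springer 10.2.8–10.2.9 generalised to any family of root
  matrices; Steinberg, *Lectures on Chevalley groups*, §§3, 5), moved to `GL (Fin N) k`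
  (`exists_fin_of_isRootDatumOf`, `GLReindex.lean`);
* `chevalley_existence_based_holds : chevalley_existence_based k`, by
  `chevalley_existence_based_of_chevalley_existence`.

## References

* [SpringerLAG1998] T. A. Springer, *Linear Algebraic Groups*, 2nd ed., Progress in Mathematics 9,
  Birkhäuser (1998): Thm 10.1.1 (p. 175), 7.4.5, Prop 8.2.4 (i), 9.6.1.
-/

namespace Literature.NumberTheory.Automorphic

variable (k : Type*) [Field k]
variable {ι X Y : Type*} [AddCommGroup X] [AddCommGroup Y]

/-- **Chevalley's existence theorem, unbased form from the based form.** If every reduced based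
root datum `(P, b)` over the algebraically closed field `k` of characteristic `0` is the based
root datum of a triple `(G, B, T)` (`chevalley_existence_based`), then every reduced root datum
`P` is the root datum of a pair `(G, T)` (`chevalley_existence`): choose a base `b` of `P`
(`RootPairing.nonempty_base_int`) and forget `B` and the pinning.
[cite: SpringerLAG1998, Thm 10.1.1 with 7.4.5] -/
theorem chevalley_existence_of_chevalley_existence_based
    (h : chevalley_existence_based k (ι := ι) (X := X) (Y := Y)) :
    chevalley_existence k (ι := ι) (X := X) (Y := Y) := by
  intro _ _ _ _ _ P _
  obtain ⟨b⟩ := P.nonempty_base_int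
  obtain ⟨N, G, B, T, hcomm, eX, eY, hB, hG, hT, -⟩ := h P b
  exact ⟨N, G, T, hcomm, eX, eY, hG, hT, hB.isRootDatumOf⟩

/-- **The unbased and based forms of Chevalley's existence theorem are equivalent** (over an
algebraically closed field of characteristic `0`, for reduced root data with finitely many roots
and finitely generated lattices): `chevalley_existence ↔ chevalley_existence_based`, by
`chevalley_existence_based_of_chevalley_existence` (Borel subgroup `B(b)` and pinning of a
realization, Springer 8.2.4 (i), 9.6.1) and `chevalley_existence_of_chevalley_existence_based`
(bases exist, Springer 7.4.5). [cite: SpringerLAG1998, Thm 10.1.1 with Prop 8.2.4 (i)] -/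
theorem chevalley_existence_iff_chevalley_existence_based :
    chevalley_existence k (ι := ι) (X := X) (Y := Y) ↔
      chevalley_existence_based k (ι := ι) (X := X) (Y := Y) :=
  ⟨chevalley_existence_based_of_chevalley_existence k,
    chevalley_existence_of_chevalley_existence_based k⟩

/-! ### The discharge of Chevalley's existence theorem -/

/-- **Chevalley's existence theorem** (Springer 10.1.1): every reduced root datum over an
algebraically closed field of characteristic `0` is the root datum of a connected reductive
`G ≤ GL_N(k)` with a maximal torus `T` — discharge of the named fact `chevalley_existence`: a
base, a Chevalley system of a Lie algebra with the relations of the datum, the family of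
finite-dimensional irreducible highest weight modules `⊕_j L(Λ_j)` whose weights generate `X`
(`ChevalleyVerma.theRootRep`), and the group `⟨T_X, exp (x E_α)⟩` of that family
(`RootRep.exists_isRootDatumOf`), reindexed to `GL (Fin N) k`.
[cite: SpringerLAG1998, Thm 10.1.1] -/
theorem chevalley_existence_holds : chevalley_existence k (ι := ι) (X := X) (Y := Y) := by
  intro _ _ _ _ _ P _
  classical
  obtain ⟨b⟩ := P.nonempty_base_int
  haveI := Fintype.ofFinite ι
  obtain ⟨L, _, _, h, e, S⟩ := exists_isChevalleySystem k P b
  haveI : Module.Free ℤ X := RootDatumBaseChange.free_of_rootPairing P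
  obtain ⟨eX, eY, hG, hT, hRD⟩ := (ChevalleyVerma.theRootRep P b S).exists_isRootDatumOf
  obtain ⟨G', T', _, eX', eY', hG', hT', hRD'⟩ := exists_fin_of_isRootDatumOf hG hT hRD
  exact ⟨_, G', T', inferInstance, eX', eY', hG', hT', hRD'⟩

/-- **Chevalley's existence theorem, based / pinned form** (Springer 10.1.1 with 8.2.4, 9.6.1):
every reduced based root datum `(P, b)` over an algebraically closed field of characteristic `0`
is the based root datum of some `(G, B, T)` — `G ≤ GL_N(k)` connected reductive, `T` a maximal
torus, `B ⊇ T` a Borel subgroup — admitting a pinning; discharge of the named fact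
`chevalley_existence_based`, by `chevalley_existence_holds` and
`chevalley_existence_based_of_chevalley_existence`.
[cite: SpringerLAG1998, Thm 10.1.1 with 8.2.4, 9.6.1] -/
theorem chevalley_existence_based_holds : chevalley_existence_based k (ι := ι) (X := X) (Y := Y) :=
  chevalley_existence_based_of_chevalley_existence k (chevalley_existence_holds k)

end Literature.NumberTheory.Automorphic
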